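import Summits.BirchSwinnertonDyer.BirchSwinnertonDyer.Theorems.ResidualThetaTransportAtTwoThetaLayerLambdaCongruenceAtTwoCuspSpanRowInductionOdd
import Summits.BirchSwinnertonDyer.BirchSwinnertonDyer.Theorems.ResidualThetaTransportAtTwoCuspSpanDefs
import HarnessLib

/-!
# Route `ThetaPartnerAtTwo` (TP2), crux μ♭ `AnalyticMuFlatCMTwoRankZero` (stmt-BirchSwinnertonDyer-26470), line `cuspspan`
# (LEAD bsd-tp2-w6 g0, skeleton sha 4bb6040ec060…): the registered stub `stub_cuspSpanOddThreeDvd`, BY NAME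

Cell `pub/bsd-wall`, width seat `bsd-tp2-w7` g0 (director-bsd keying brief (195): «w7 takes the hardest stub of w6's skeleton»;
THEOREMS ONLY — no `def`, no `sorry`; `--supports stmt-BirchSwinnertonDyer-26470`; BSD is not proved by any of this).

THE STUB (registered signature, verbatim): `∀ (N : ℕ) [NeZero N], ¬ 2 ∣ N → 3 ∣ N → SignedMuAtTwo.CuspSpanEvenAtTwo N` — the dual
cusp-span statement (G′)_N at every odd level DIVISIBLE BY `3` (the `ℚ(√−3)` / `3`-twisted tail of the CM habitat: levels `27·m²`,
`243·m²`, `9·121·m²`, …). At registration (15:04Z) it was the line's only `sorry`; it is now a COROLLARY BY NAME of the all-odd-level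
node theorem `SignedMuAtTwo.Rows.cuspSpanEvenAtTwo_of_not_two_dvd` (rtt-p3-w2 g5, file `…CuspSpanRowInductionOdd`, p643326, in the
tree 15:02Z: the row-induction step without `3 ∤ N` over the `ℓ = 3` CRT variant p642718), the hypothesis `3 ∣ N` being carried,
not used. With `stub_cuspSpanOddPrimeToThree` (proved at registration, `SignedMuAtTwo.cuspSpanEvenAtTwo_odd_of_not_three_dvd`) the
LEAD's composition `AnalyticMuFlatCMTwoRankZero_of` is then `sorry`-free. Nothing else is claimed here.

References: R. Pollack, Duke Math. J. 118 (2003), Conj. 6.3 [Pollack2003]; B. Mazur, Publ. IHÉS 47 (1977) §II.11 [Mazur1977].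
-/

set_option autoImplicit false
-- the Theorems namespace of this sub repeats the summit name by design (D-0017 nested layout)
set_option linter.dupNamespace false

noncomputable section

namespace Summit.BirchSwinnertonDyer.BirchSwinnertonDyer.Theorems.AnalyticMuFlatAtTwo

/-- **Stub `stub_cuspSpanOddThreeDvd` of line `cuspspan` (crux μ♭, stmt-BirchSwinnertonDyer-26470), registered signature VERBATIM:
(G′)_N = `SignedMuAtTwo.CuspSpanEvenAtTwo N` at every odd level `N` divisible by `3`** — by name from the all-odd-level node theorem
`SignedMuAtTwo.Rows.cuspSpanEvenAtTwo_of_not_two_dvd` (the binder `3 ∣ N` is carried, not used). BSD is not proved by this.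
[cite: Pollack2003, Conj. 6.3] [cite: Mazur1977, §II.11] -/
theorem stub_cuspSpanOddThreeDvd :
    ∀ (N : ℕ) [NeZero N], ¬ 2 ∣ N → 3 ∣ N →
      Summit.BirchSwinnertonDyer.BirchSwinnertonDyer.Theorems.SignedMuAtTwo.CuspSpanEvenAtTwo N :=
  fun N _ h2 _ ↦ SignedMuAtTwo.Rows.cuspSpanEvenAtTwo_of_not_two_dvd N h2

end Summit.BirchSwinnertonDyer.BirchSwinnertonDyer.Theorems.AnalyticMuFlatAtTwo

end
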